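import Summits.CriticalPhenomena.SAWScalingLimit.Theorems.SAWLeftRightFKGLeftRightFKGDefs
import Summits.CriticalPhenomena.SAWScalingLimit.Theorems.SAWLeftRightFKGLeftRightFKGStubStepMonotoneAux1
import Summits.CriticalPhenomena.SAWScalingLimit.Theorems.SAWLeftRightFKGLeftRightFKGStubStepMonotoneAux2
import HarnessLib

/-!
# Stub `stub_stepMonotone` of line `corner-localisation`

Crux `LeftRightFKG` (stmt-CriticalPhenomena-11232), vocabulary module
`Summits.CriticalPhenomena.SAWScalingLimit.Theorems.SAWLeftRightFKGLeftRightFKGDefs`; helper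
files `…StubStepMonotoneAux1` (crossing formulas) and `…StubStepMonotoneAux2` (class-constancy).

STEP-RANK MONOTONICITY. Fix a crux instance at mesh `1`, a position `k` and a prefix `π`. Two
distinct chords `γ₁ ≼ γ₂` agreeing with `π` up to position `k` both pass `p = π k` at position `k`
and leave it to lattice neighbours `n₁`, `n₂ ≠ p'`, where the reference neighbour `p'` is `a'` for
`k = 0` and `π (k-1)` for `k ≥ 1`. Let `W_F` be the winding number of the lens `γ₁ · γ₂⁻¹` about
the centre of the face `F ∈ {NE, NW, SW, SE}` at `p`. Then `W_F ≥ 0` (the order), `W_F = 0` for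
the two faces with corner `p'` (`StepMono.wind_lens_probeL_eq_zero`), and across the edge from `p`
in direction `X` the value of `W` jumps by `[n₁ = X] - [n₂ = X]` (vertical-probe dart sums for
`X = E, W`, horizontal ones for `X = N, S`: `StepMono.lens_jump`). Reading the four faces
counter-clockwise from `p'` forces the counter-clockwise angular rank of `n₁` (from `p'`) to be at
most that of `n₂` (`StepMono.rank_le`). General mesh by `MeshReduction`; the suffix statement by
reversing the chords (`StepMono.lr_reverse`) and the ranking.
-/

noncomputable section

open Set Complex Literature.Probability.LatticeModels Literature.Probability.RandomPlanarGeometry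
open Literature.Topology.PlaneTopology
open Summit.CriticalPhenomena.SAWScalingLimit.Theorems.LeftRightFKG.Negative

namespace Summit.CriticalPhenomena.SAWScalingLimit.Theorems.LeftRightFKG.CornerLoc

namespace StepMono

/-! ## The counter-clockwise ranking of the neighbours of `p` from the direction `d` -/

/-- Comparison of indicators. [folklore] -/
theorem ind_le_ind {P Q : Prop} [Decidable P] [Decidable Q]
    (h : (if P then (1 : ℤ) else 0) ≤ (if Q then 1 else 0)) : P → Q := fun hp => by
  by_contra hq
  rw [if_pos hp, if_neg hq] at h
  exact absurd h (by norm_num)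

/-- The ranking takes values `≤ 3`. [folklore] -/
theorem rank_le_three (p : Site 2) (d0 d1 : ℤ) (v : Site 2) :
    (if v 0 = p 0 - d1 ∧ v 1 = p 1 + d0 then 1 else if v 0 = p 0 - d0 ∧ v 1 = p 1 - d1 then 2
      else if v 0 = p 0 + d1 ∧ v 1 = p 1 - d0 then 3 else (0 : ℕ)) ≤ 3 := by
  split_ifs <;> omega

/-- The ranking (rank `1, 2, 3` for `p + i d, p - d, p - i d`, rank `0` otherwise) is injective on
the four lattice neighbours of `p`, for a unit lattice vector `d`: the rank of a neighbour
determines it. [folklore] -/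
theorem rank_injOn (p : Site 2) {d0 d1 : ℤ}
    (hd : (d0 = 1 ∧ d1 = 0) ∨ (d0 = -1 ∧ d1 = 0) ∨ (d0 = 0 ∧ d1 = 1) ∨ (d0 = 0 ∧ d1 = -1)) :
    Set.InjOn (fun v : Site 2 => if v 0 = p 0 - d1 ∧ v 1 = p 1 + d0 then 1
      else if v 0 = p 0 - d0 ∧ v 1 = p 1 - d1 then 2
      else if v 0 = p 0 + d1 ∧ v 1 = p 1 - d0 then 3 else (0 : ℕ)) ((zdGraph 2).neighborSet p) := by
  generalize hR : (fun v : Site 2 => if v 0 = p 0 - d1 ∧ v 1 = p 1 + d0 then 1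
      else if v 0 = p 0 - d0 ∧ v 1 = p 1 - d1 then 2
      else if v 0 = p 0 + d1 ∧ v 1 = p 1 - d0 then 3 else (0 : ℕ)) = R
  have key : ∀ v : Site 2, (zdGraph 2).Adj p v →
      (R v = 1 ∧ v = bx (p 0 - d1) (p 1 + d0)) ∨ (R v = 2 ∧ v = bx (p 0 - d0) (p 1 - d1)) ∨
        (R v = 3 ∧ v = bx (p 0 + d1) (p 1 - d0)) ∨ (R v = 0 ∧ v = bx (p 0 + d0) (p 1 + d1)) := by
    intro v hv
    simp only [← hR, eq_bx_iff]
    split_ifs with c1 c2 c3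
    · exact Or.inl ⟨rfl, c1⟩
    · exact Or.inr (Or.inl ⟨rfl, c2⟩)
    · exact Or.inr (Or.inr (Or.inl ⟨rfl, c3⟩))
    · refine Or.inr (Or.inr (Or.inr ⟨rfl, ?_⟩))
      rcases adj_cases hv with h | h | h | h <;> omega
  intro v hv w hw h
  rw [SimpleGraph.mem_neighborSet] at hv hw
  rcases key v hv with ⟨h1, e1⟩ | ⟨h1, e1⟩ | ⟨h1, e1⟩ | ⟨h1, e1⟩ <;>
  rcases key w hw with ⟨h2, e2⟩ | ⟨h2, e2⟩ | ⟨h2, e2⟩ | ⟨h2, e2⟩ <;>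
  first
  | exact e1.trans e2.symm
  | (rw [h1, h2] at h; exact absurd h (by decide))

/-- **The angular endgame.** For a neighbour `n₂ ≠ p + d` of `p` and any `n₁`: if `n₂ = p + i d`
forces `n₁ = p + i d` and `n₁ = p - i d` forces `n₂ = p - i d`, then `rank n₁ ≤ rank n₂`.
[folklore] -/
theorem rank_le {p n₁ n₂ : Site 2} {d0 d1 : ℤ}
    (hd : (d0 = 1 ∧ d1 = 0) ∨ (d0 = -1 ∧ d1 = 0) ∨ (d0 = 0 ∧ d1 = 1) ∨ (d0 = 0 ∧ d1 = -1))
    (hn₂ : (zdGraph 2).Adj p n₂) (hne₂ : ¬(n₂ 0 = p 0 + d0 ∧ n₂ 1 = p 1 + d1))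
    (hq₁ : n₂ 0 = p 0 - d1 ∧ n₂ 1 = p 1 + d0 → n₁ 0 = p 0 - d1 ∧ n₁ 1 = p 1 + d0)
    (hq₃ : n₁ 0 = p 0 + d1 ∧ n₁ 1 = p 1 - d0 → n₂ 0 = p 0 + d1 ∧ n₂ 1 = p 1 - d0) :
    (if n₁ 0 = p 0 - d1 ∧ n₁ 1 = p 1 + d0 then 1 else if n₁ 0 = p 0 - d0 ∧ n₁ 1 = p 1 - d1 then 2
      else if n₁ 0 = p 0 + d1 ∧ n₁ 1 = p 1 - d0 then 3 else (0 : ℕ)) ≤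
    (if n₂ 0 = p 0 - d1 ∧ n₂ 1 = p 1 + d0 then 1 else if n₂ 0 = p 0 - d0 ∧ n₂ 1 = p 1 - d1 then 2
      else if n₂ 0 = p 0 + d1 ∧ n₂ 1 = p 1 - d0 then 3 else (0 : ℕ)) := by
  have h3 : (n₂ 0 = p 0 - d1 ∧ n₂ 1 = p 1 + d0) ∨ (n₂ 0 = p 0 - d0 ∧ n₂ 1 = p 1 - d1) ∨
      (n₂ 0 = p 0 + d1 ∧ n₂ 1 = p 1 - d0) := by
    revert hd hne₂
    rcases adj_cases hn₂ with h | h | h | h <;> omega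
  revert hd hq₁ hq₃ h3
  split_ifs <;> omega

/-! ## The prefix statement at mesh `1` -/

/-- **STEP-RANK MONOTONICITY AT MESH `1` (prefix form).** For a boundary walk `C`, endpoints `a`,
`b`, a vertex `a'` of `C` adjacent to `a`, and `LoopWindVanish`: for every `k`, `π` there is a
ranking of the lattice neighbours of `π k` with values `≤ 3`, injective on the neighbour set, such
that among chords of `(C, 1)` from `a` to `b` agreeing with `π` up to position `k`, the rank of the
vertex at position `k + 1` is monotone in the left–right order. [folklore] -/
theorem core (hL : LoopWindVanish) {c : Site 2} (C : (zdGraph 2).Walk c c) {a b a' : Site 2}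
    (ha' : a' ∈ C.support) (haa' : (zdGraph 2).Adj a a') (k : ℕ) (π : ℕ → Site 2) :
    ∃ r : Site 2 → ℕ, (∀ v, r v ≤ 3) ∧ Set.InjOn r ((zdGraph 2).neighborSet (π k)) ∧
      ∀ γ₁ γ₂ : SAW.DomainSAW (dom C 1) 1 a b, AgreeTo k π γ₁ → AgreeTo k π γ₂ → lr γ₁ γ₂ →
        r (γ₁.walk.getVert (k + 1)) ≤ r (γ₂.walk.getVert (k + 1)) := by
  have hG := adj_of_adj C
  by_cases hex : ∃ γ₁ γ₂ : SAW.DomainSAW (dom C 1) 1 a b,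
      AgreeTo k π γ₁ ∧ AgreeTo k π γ₂ ∧ γ₁ ≠ γ₂
  swap
  · -- at most one chord in the class: any injective ranking
    refine ⟨_, rank_le_three (π k) 0 (-1), rank_injOn (π k) (Or.inr (Or.inr (Or.inr ⟨rfl, rfl⟩))),
      ?_⟩
    intro γ₁ γ₂ h₁ h₂ _
    have : γ₁ = γ₂ := by
      by_contra hne
      exact hex ⟨γ₁, γ₂, h₁, h₂, hne⟩
    rw [this]
  obtain ⟨γ₀, γ₀', h₀, h₀', hne₀⟩ := hex
  have hk₀ : k < γ₀.walk.length := lt_length_of_ne h₀ h₀' hne₀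
  -- the reference neighbour `p'` of `p = π k`
  obtain ⟨p', hp'₀, hp'₁⟩ : ∃ p' : Site 2, (k = 0 → p' = a') ∧ (0 < k → p' = π (k - 1)) :=
    ⟨if k = 0 then a' else π (k - 1), fun h => by simp [h], fun h => by simp [h.ne']⟩
  have hadj : (zdGraph 2).Adj (π k) p' := by
    rcases Nat.eq_zero_or_pos k with hk | hk
    · rw [hp'₀ hk, ← h₀ k le_rfl, hk, SimpleGraph.Walk.getVert_zero]
      exact haa'
    · rw [hp'₁ hk, ← h₀ k le_rfl, ← h₀ (k - 1) (Nat.sub_le k 1)]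
      have h := γ₀.walk.adj_getVert_succ (i := k - 1) (by omega)
      rw [Nat.sub_add_cancel hk] at h
      exact (hG _ _ h).symm
  have ha'dom := not_mem_dom_of_mem_support C ha'
  -- the direction `d = p' - p` is a unit lattice vector
  have hd : (p' 0 - π k 0 = 1 ∧ p' 1 - π k 1 = 0) ∨ (p' 0 - π k 0 = -1 ∧ p' 1 - π k 1 = 0) ∨
      (p' 0 - π k 0 = 0 ∧ p' 1 - π k 1 = 1) ∨ (p' 0 - π k 0 = 0 ∧ p' 1 - π k 1 = -1) := by
    rcases adj_cases hadj with h | h | h | h <;> omega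
  refine ⟨_, rank_le_three (π k) (p' 0 - π k 0) (p' 1 - π k 1), rank_injOn (π k) hd, ?_⟩
  intro γ₁ γ₂ h₁ h₂ h₁₂
  by_cases hne : γ₁ = γ₂
  · rw [hne]
  have hk₁ : k < γ₁.walk.length := lt_length_of_ne h₁ h₂ hne
  have hk₂ : k < γ₂.walk.length := lt_length_of_ne h₂ h₁ (Ne.symm hne)
  have hk : ∀ i ≤ k, γ₁.walk.getVert i = γ₂.walk.getVert i :=
    fun i hi => (h₁ i hi).trans (h₂ i hi).symm
  have hpk : γ₁.walk.getVert k = π k := h₁ k le_rfl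
  -- the next vertex `n₂ = γ₂ (k+1)` is a lattice neighbour of `p` other than `p'`
  have hn₂ : (zdGraph 2).Adj (π k) (γ₂.walk.getVert (k + 1)) := by
    rw [← h₂ k le_rfl]
    exact hG _ _ (γ₂.walk.adj_getVert_succ hk₂)
  have hnp : γ₂.walk.getVert (k + 1) ≠ p' := by
    rcases Nat.eq_zero_or_pos k with hk0 | hk0
    · rw [hp'₀ hk0]
      exact fun h => not_mem_support_of_not_mem_dom C γ₂.walk ha'dom haa'.ne.symm
        (h ▸ γ₂.walk.getVert_mem_support _)
    · rw [hp'₁ hk0, ← h₂ (k - 1) (Nat.sub_le k 1)]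
      intro h
      have := γ₂.isPath.getVert_injOn (by simp only [Set.mem_setOf_eq]; omega)
        (by simp only [Set.mem_setOf_eq]; omega) h
      omega
  have hne₂ : ¬((γ₂.walk.getVert (k + 1)) 0 = π k 0 + (p' 0 - π k 0) ∧
      (γ₂.walk.getVert (k + 1)) 1 = π k 1 + (p' 1 - π k 1)) := fun h =>
    hnp (((eq_bx_iff _ _ _).2 ⟨by omega, by omega⟩).trans (eq_bx p').symm)
  -- the lens: non-negative winding numbers, zero at the faces with corner `p'`
  have hnn : ∀ m k' : ℤ, 0 ≤ wind (fun t : ℝ => IccExtend zero_le_one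
      ((γ₁.walk.append γ₂.walk.reverse).toCurve (meshPoint 1)) t - probeL m k') := fun m k' => h₁₂ _
  have hz : ∀ m k' : ℤ, (p' 0 = m ∨ p' 0 = m + 1) → (p' 1 = k' ∨ p' 1 = k' + 1) →
      wind (fun t : ℝ => IccExtend zero_le_one
        ((γ₁.walk.append γ₂.walk.reverse).toCurve (meshPoint 1)) t - probeL m k') = 0 :=
    fun m k' h0 h1 => wind_lens_probeL_eq_zero hL C ha' haa' γ₁ γ₂ hk hk₁ hk₂ hp'₀
      (fun h => (hp'₁ h).trans (h₁ (k - 1) (Nat.sub_le k 1)).symm) h0 h1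
  -- the crossing formulas at the four faces `NE, SE, NW, SW` at `p`
  have fNE := wind_loop_probeL hG (γ₁.walk.append γ₂.walk.reverse) (π k 0) (π k 1)
  have fSE := wind_loop_probeL hG (γ₁.walk.append γ₂.walk.reverse) (π k 0) (π k 1 - 1)
  have fNW := wind_loop_probeL hG (γ₁.walk.append γ₂.walk.reverse) (π k 0 - 1) (π k 1)
  have fSW := wind_loop_probeL hG (γ₁.walk.append γ₂.walk.reverse) (π k 0 - 1) (π k 1 - 1)
  have gNE := wind_loop_probeL_rot hG (γ₁.walk.append γ₂.walk.reverse) (π k 0) (π k 1)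
  have gSE := wind_loop_probeL_rot hG (γ₁.walk.append γ₂.walk.reverse) (π k 0) (π k 1 - 1)
  have gNW := wind_loop_probeL_rot hG (γ₁.walk.append γ₂.walk.reverse) (π k 0 - 1) (π k 1)
  have gSW := wind_loop_probeL_rot hG (γ₁.walk.append γ₂.walk.reverse) (π k 0 - 1) (π k 1 - 1)
  -- the jumps across the four edges at `p`
  have JE := lens_jump γ₁.isPath γ₂.isPath hk hk₁ hk₂ (edgeCross (π k 0) (π k 1 - 1))
    (edgeCross (π k 0) (π k 1)) (edgeCross_symm _ _) (edgeCross_symm _ _)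
    (bx (π k 0 + 1) (π k 1)) (fun x y => by rw [hpk]; exact edgeCross_jump_E (π k) x y)
  have JW := lens_jump γ₁.isPath γ₂.isPath hk hk₁ hk₂ (edgeCross (π k 0 - 1) (π k 1))
    (edgeCross (π k 0 - 1) (π k 1 - 1)) (edgeCross_symm _ _) (edgeCross_symm _ _)
    (bx (π k 0 - 1) (π k 1)) (fun x y => by rw [hpk]; linarith [edgeCross_jump_W (π k) x y])
  have JN := lens_jump γ₁.isPath γ₂.isPath hk hk₁ hk₂
    (fun x y => edgeCross (-(π k 1) - 1) (π k 0) (bx (-x 1) (x 0)) (bx (-y 1) (y 0)))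
    (fun x y => edgeCross (-(π k 1) - 1) (π k 0 - 1) (bx (-x 1) (x 0)) (bx (-y 1) (y 0)))
    (fun x y => edgeCross_symm _ _ _ _) (fun x y => edgeCross_symm _ _ _ _)
    (bx (π k 0) (π k 1 + 1))
    (fun x y => by rw [hpk]; linarith [edgeCross_rot_jump_N (π k) x y])
  have JS := lens_jump γ₁.isPath γ₂.isPath hk hk₁ hk₂
    (fun x y => edgeCross (-(π k 1 - 1) - 1) (π k 0 - 1) (bx (-x 1) (x 0)) (bx (-y 1) (y 0)))
    (fun x y => edgeCross (-(π k 1 - 1) - 1) (π k 0) (bx (-x 1) (x 0)) (bx (-y 1) (y 0)))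
    (fun x y => edgeCross_symm _ _ _ _) (fun x y => edgeCross_symm _ _ _ _)
    (bx (π k 0) (π k 1 - 1))
    (fun x y => by rw [hpk]; exact edgeCross_rot_jump_S (π k) x y)
  beta_reduce at JN JS
  -- translation between site equalities and coordinates
  have bridge : ∀ {n n' : Site 2} {i j : ℤ}, (n = bx i j → n' = bx i j) →
      (n 0 = i ∧ n 1 = j → n' 0 = i ∧ n' 1 = j) :=
    fun imp h => (eq_bx_iff _ _ _).1 (imp ((eq_bx_iff _ _ _).2 h))
  -- the endgame, by direction of `p'`
  refine rank_le hd hn₂ hne₂ ?_ ?_ <;>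
  rcases adj_cases hadj with hE | hW | hN | hS
  · -- `p' = E`, ray `q₁ = N`
    have z := hz (π k 0) (π k 1) (Or.inr hE.1) (Or.inl hE.2)
    have i : γ₂.walk.getVert (k + 1) = bx (π k 0) (π k 1 + 1) →
        γ₁.walk.getVert (k + 1) = bx (π k 0) (π k 1 + 1) :=
      ind_le_ind (by linarith [hnn (π k 0 - 1) (π k 1)])
    exact fun h => by have := bridge i ⟨by omega, by omega⟩; exact ⟨by omega, by omega⟩
  · -- `p' = W`, ray `q₁ = S`
    have z := hz (π k 0 - 1) (π k 1 - 1) (Or.inl (by omega)) (Or.inr (by omega))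
    have i : γ₂.walk.getVert (k + 1) = bx (π k 0) (π k 1 - 1) →
        γ₁.walk.getVert (k + 1) = bx (π k 0) (π k 1 - 1) :=
      ind_le_ind (by linarith [hnn (π k 0) (π k 1 - 1)])
    exact fun h => by have := bridge i ⟨by omega, by omega⟩; exact ⟨by omega, by omega⟩
  · -- `p' = N`, ray `q₁ = W`
    have z := hz (π k 0 - 1) (π k 1) (Or.inr (by omega)) (Or.inr (by omega))
    have i : γ₂.walk.getVert (k + 1) = bx (π k 0 - 1) (π k 1) →
        γ₁.walk.getVert (k + 1) = bx (π k 0 - 1) (π k 1) :=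
      ind_le_ind (by linarith [hnn (π k 0 - 1) (π k 1 - 1)])
    exact fun h => by have := bridge i ⟨by omega, by omega⟩; exact ⟨by omega, by omega⟩
  · -- `p' = S`, ray `q₁ = E`
    have z := hz (π k 0) (π k 1 - 1) (Or.inl hS.2) (Or.inl (by omega))
    have i : γ₂.walk.getVert (k + 1) = bx (π k 0 + 1) (π k 1) →
        γ₁.walk.getVert (k + 1) = bx (π k 0 + 1) (π k 1) :=
      ind_le_ind (by linarith [hnn (π k 0) (π k 1)])
    exact fun h => by have := bridge i ⟨by omega, by omega⟩; exact ⟨by omega, by omega⟩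
  · -- `p' = E`, ray `q₃ = S`
    have z := hz (π k 0) (π k 1 - 1) (Or.inr hE.1) (Or.inr (by omega))
    have i : γ₁.walk.getVert (k + 1) = bx (π k 0) (π k 1 - 1) →
        γ₂.walk.getVert (k + 1) = bx (π k 0) (π k 1 - 1) :=
      ind_le_ind (by linarith [hnn (π k 0 - 1) (π k 1 - 1)])
    exact fun h => by have := bridge i ⟨by omega, by omega⟩; exact ⟨by omega, by omega⟩
  · -- `p' = W`, ray `q₃ = N`
    have z := hz (π k 0 - 1) (π k 1) (Or.inl (by omega)) (Or.inl hW.2)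
    have i : γ₁.walk.getVert (k + 1) = bx (π k 0) (π k 1 + 1) →
        γ₂.walk.getVert (k + 1) = bx (π k 0) (π k 1 + 1) :=
      ind_le_ind (by linarith [hnn (π k 0) (π k 1)])
    exact fun h => by have := bridge i ⟨by omega, by omega⟩; exact ⟨by omega, by omega⟩
  · -- `p' = N`, ray `q₃ = E`
    have z := hz (π k 0) (π k 1) (Or.inl hN.2) (Or.inr (by omega))
    have i : γ₁.walk.getVert (k + 1) = bx (π k 0 + 1) (π k 1) →
        γ₂.walk.getVert (k + 1) = bx (π k 0 + 1) (π k 1) :=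
      ind_le_ind (by linarith [hnn (π k 0) (π k 1 - 1)])
    exact fun h => by have := bridge i ⟨by omega, by omega⟩; exact ⟨by omega, by omega⟩
  · -- `p' = S`, ray `q₃ = W`
    have z := hz (π k 0 - 1) (π k 1 - 1) (Or.inr (by omega)) (Or.inl (by omega))
    have i : γ₁.walk.getVert (k + 1) = bx (π k 0 - 1) (π k 1) →
        γ₂.walk.getVert (k + 1) = bx (π k 0 - 1) (π k 1) :=
      ind_le_ind (by linarith [hnn (π k 0 - 1) (π k 1)])
    exact fun h => by have := bridge i ⟨by omega, by omega⟩; exact ⟨by omega, by omega⟩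

end StepMono

/-! ## The registered stub -/

/-- **STEP-RANK MONOTONICITY** (registered stub `stub_stepMonotone` of line `corner-localisation`):
from `MeshReduction` and `LoopWindVanish`, for every crux instance the chord type is finite and,
for every `k`, `π` (resp. `m`, `σ`), there is a ranking of the lattice neighbours of `π k` (resp.
`σ m`), injective on the neighbour set, such that among chords agreeing with `π` up to position `k`
(resp. whose reversal agrees with `σ` up to position `m`) the rank of the next (resp. previous)
vertex is monotone in the left–right order. Mesh `δ` is reduced to mesh `1` along the
support-preserving order-isomorphism of `MeshReduction`; the suffix form is the prefix form for the
reversed chords from `b` to `a` (`lr_reverse`) with the ranking reversed (`3 - r`). [folklore] -/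
theorem stub_stepMonotone : MeshReduction → LoopWindVanish → StepMonotone := by
  intro hM hL δ c a b a' b' C hI
  obtain ⟨hδ, ha', hb', haa', hbb'⟩ := hI
  obtain ⟨e, he, hlr⟩ := hM δ c a b C hδ
  have hget : ∀ (γ : SAW.DomainSAW (dom C δ) δ a b) (i : ℕ),
      (e γ).walk.getVert i = γ.walk.getVert i :=
    fun γ i => StepMono.getVert_eq_of_support_eq _ _ (he γ) i
  have hgetR : ∀ (γ : SAW.DomainSAW (dom C δ) δ a b) (i : ℕ),
      (e γ).walk.reverse.getVert i = γ.walk.reverse.getVert i := fun γ i =>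
    StepMono.getVert_eq_of_support_eq _ _
      (by rw [SimpleGraph.Walk.support_reverse, SimpleGraph.Walk.support_reverse, he γ]) i
  refine ⟨finite_domainSAW C hδ, fun k π => ?_, fun m σ => ?_⟩
  · obtain ⟨r, -, hinj, hmono⟩ := StepMono.core hL C ha' haa' k π
    refine ⟨r, hinj, fun γ₁ γ₂ h₁ h₂ h₁₂ => ?_⟩
    have := hmono (e γ₁) (e γ₂) (fun i hi => (hget γ₁ i).trans (h₁ i hi))
      (fun i hi => (hget γ₂ i).trans (h₂ i hi)) ((hlr γ₁ γ₂).1 h₁₂)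
    rwa [hget, hget] at this
  · obtain ⟨r, hr3, hinj, hmono⟩ := StepMono.core hL C hb' hbb' m σ
    refine ⟨fun v => 3 - r v, fun v hv w hw h => hinj hv hw ?_, fun γ₁ γ₂ h₁ h₂ h₁₂ => ?_⟩
    · have := hr3 v
      have := hr3 w
      simp only at h
      omega
    · have := hmono ⟨(e γ₂).walk.reverse, (e γ₂).isPath.reverse⟩
        ⟨(e γ₁).walk.reverse, (e γ₁).isPath.reverse⟩
        (fun j hj => (hgetR γ₂ j).trans (h₂ j hj)) (fun j hj => (hgetR γ₁ j).trans (h₁ j hj))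
        (StepMono.lr_reverse C (e γ₁) (e γ₂) ((hlr γ₁ γ₂).1 h₁₂))
      simp only at this
      rw [hgetR, hgetR] at this
      simp only
      omega

end Summit.CriticalPhenomena.SAWScalingLimit.Theorems.LeftRightFKG.CornerLoc

end
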